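import Summits.Parity.BatemanHorn.Theses.RoughValueTransport
import Summits.Parity.BatemanHorn.Theorems.RoughValueTransportRoughValueLawOmegaFacts
import HarnessLib

/-!
# Route `RoughValueTransport`, crux `RoughValueLaw` (stmt-Parity-11390), line
# `omega-class-shape-split`: the registered stub `stub_buchstabUnique`

`--supports` file of the checked skeleton
`Summits/Parity/BatemanHorn/Cruxes/RoughValueLaw/Lines/omega-class-shape-split.lean`
(crux `Summit.Parity.BatemanHorn.Theses.RoughValueTransport.RoughValueLaw`).  It PROVES the
registered stub, verbatim:
`stub_buchstabUnique : ∀ ω : ℝ → ℝ, ((∀ u, 1 ≤ u → u ≤ 2 → ω u = u⁻¹) ∧ ContinuousOn ω (Ici 1) ∧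
(∀ u, 2 < u → HasDerivAt (fun t => t * ω t) (ω (u - 1)) u)) → ∀ u, 2 < u → ω u = buchstabOmega u`
— the crux's INLINE Buchstab predicate (`ω = 1/u` on `[1,2]`, continuity on `[1,∞)`,
`(uω(u))' = ω(u−1)` for `u > 2`) has exactly one solution on `(2, ∞)`, the tree's Buchstab
function `Literature.NumberTheory.Sieve.buchstabOmega`.

The uniqueness (method of steps / Lagrange's mean value theorem) is already PROVED in the tree on
all of `[1, ∞)` as
`Summit.Parity.BatemanHorn.Cruxes.RoughValueLaw.IncrementAnchoring.OmegaFacts.eq_buchstabOmega`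
(`Theorems/RoughValueTransportRoughValueLawOmegaFacts.lean`, line `increment-anchoring`); this
file specialises it to `u > 2`.  No definition and no new fact is introduced.

References: G. Harman, *Prime-Detecting Sieves* (2007), §1.4 and Appendix A.2; the line card
`Cruxes/RoughValueLaw/Lines/omega-class-shape-split.md`.
-/

noncomputable section

open Filter Finset Polynomial
open Literature.NumberTheory.Sieve
open scoped BigOperators Topology

namespace Summit.Parity.BatemanHorn.Cruxes.RoughValueLaw.OmegaClassShapeSplit

/-- **stub_buchstabUnique** (registered stub of the skeleton
`Cruxes/RoughValueLaw/Lines/omega-class-shape-split.lean`, crux stmt-Parity-11390).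
**Uniqueness of Buchstab's function on `(2, ∞)`.**  Any `ω` with `ω(u) = 1/u` on `[1,2]`,
continuous on `[1,∞)` and with `(uω(u))' = ω(u−1)` for `u > 2` coincides with the tree's
`buchstabOmega` at every `u > 2` — a special case of
`IncrementAnchoring.OmegaFacts.eq_buchstabOmega` (equality on all of `[1,∞)`, method of steps).
[folklore] -/
theorem stub_buchstabUnique :
    ∀ ω : ℝ → ℝ, ((∀ u : ℝ, 1 ≤ u → u ≤ 2 → ω u = u⁻¹) ∧ ContinuousOn ω (Set.Ici 1) ∧ (∀ u : ℝ,
      2 < u → HasDerivAt (fun t : ℝ => t * ω t) (ω (u - 1)) u)) → ∀ u : ℝ, 2 < u → ω u =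
      buchstabOmega u := by
  rintro ω ⟨hinit, hcont, hdde⟩ u hu
  exact IncrementAnchoring.OmegaFacts.eq_buchstabOmega hinit hcont hdde (by linarith)

end Summit.Parity.BatemanHorn.Cruxes.RoughValueLaw.OmegaClassShapeSplit

end
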